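import Mathlib
import HarnessLib
import Literature.NumberTheory.LFunctions.ZetaScrew
import Summits.RiemannHypothesis.RiemannHypothesis.Theorems.IntegerScrewRung128
import Summits.RiemannHypothesis.RiemannHypothesis.Theorems.MotivicDoorSemilocalClosed
import Summits.RiemannHypothesis.RiemannHypothesis.Theorems.WeilFormatCDataA1RungCB
import Summits.RiemannHypothesis.RiemannHypothesis.Theorems.IntegerScrewTopBlockNegHead
import Summits.RiemannHypothesis.RiemannHypothesis.Theorems.DbrLatticeAntipersistence
import Summits.RiemannHypothesis.RiemannHypothesis.Theorems.DbrWallLogTableA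
import Summits.RiemannHypothesis.RiemannHypothesis.Theorems.InventoryDeletionBlindness

/-!
# W-06 cycle 5, cell C4⁵ (T) «DELETION-UNIFORM TRANSFERS» — Detection at p₁ = 2 + Calibration

Detection (§5): for every finite `D ∋ 2`, `det S_3(ζ_{ℙ∖D}) < 0` (kernel certificate on the
tree's enclosures) — so `M₀(ℙ∖D) = 3 = p₁ + 1`.

Calibration (§6): the PIN `uniformWSTransfer_pin_two`: every W→S transfer uniform over the kept
class has `f((log 2)/2) ≤ 2 = e^{2a}` (the tree's `⌊e^{2a}⌋` is sharp there).

TEST 0: both sides are finite rungs; 0 bits toward `Re ρ(ζ)`. Nothing here bears on the truth of RH.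
-/

set_option linter.dupNamespace false

namespace RhIdea6.G14.Transfer

open Literature.NumberTheory.LFunctions Finset
open Summit.RiemannHypothesis.RiemannHypothesis.Theorems.IntegerScrew
open Summit.RiemannHypothesis.RiemannHypothesis.Theorems.MotivicDoor.Semilocal
open Summit.RiemannHypothesis.RiemannHypothesis.Theorems.WeilFormatCData.A1
open scoped BigOperators

/-! ## §5. Detection twin at the floor: `2 ∈ D` is seen by SCREW at `M = 3` (kernel certificate)

For EVERY finite `D ∋ 2` the kept `S_3` (nodes `log 2, log 3`) is the fixed matrix
`[[2Ψ(log 2), Ψ(log 2)+Ψ(log 3)+φ₃−Ψ(log 3/2)], [·, 2Ψ(log 3)+2φ₃]]`, `φ₃ = (log 2)(log 3 − log 2)/√2`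
(the only deleted power below `3` that carries a non-zero hinge at these arguments is `2`, at `t = log 3`),
and its determinant is NEGATIVE (`≈ −0.0157`): certified from the tree's rung-128 enclosures
`DbrLattice.mem_uR_utab127` of `u(2,1), u(3,1), u(3,2)`, the brackets `cLoQ ≤ C ≤ cHiQ`, Mathlib's
`log 2` digits, the tree's `log 3` digits and `√2 ∈ (1.414213, 1.414214)`. With §3 (`n = 1`: blind at
`M = 2` needs `2 < p`, i.e. `2 ∉ D`) this pins the detection index `M₀(ℙ∖D) = 3` for every `D ∋ 2`
whose other primes are arbitrary. -/

open Literature.Analysis.ValidatedNumerics Literature.Analysis.ValidatedNumerics.Numerics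
open Summit.RiemannHypothesis.RiemannHypothesis.Theorems.IntegerScrew.RungCert
open Summit.RiemannHypothesis.RiemannHypothesis.Theorems.IntegerScrew.TopBlockNeg
open Summit.RiemannHypothesis.RiemannHypothesis.Theorems.DbrLattice
open Summit.RiemannHypothesis.RiemannHypothesis.Theorems.DbrWall.LogTable (log_three_bounds)

/-- `Ψ_D` is even. [folklore] -/
theorem keptScrew_neg (D : Finset ℕ) (t : ℝ) : keptScrew D (-t) = keptScrew D t := by
  simp [keptScrew, deletedHinge, zetaScrew_neg, abs_neg]

/-- `Ψ_D(0) = 0`. [folklore] -/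
theorem keptScrew_zero' (D : Finset ℕ) : keptScrew D 0 = 0 := by
  unfold keptScrew deletedHinge
  rw [zetaScrew_zero, abs_zero, Real.exp_zero]
  simp [ArithmeticFunction.vonMangoldt_apply_one]

/-- The deleted hinge sum at a node `log m`: the floor is `m`. [folklore] -/
theorem deletedHinge_log_nat (D : Finset ℕ) {m : ℕ} (hm : 1 ≤ m) :
    deletedHinge D (Real.log m) = ∑ n ∈ Icc 1 m,
      (if n.minFac ∈ D then (ArithmeticFunction.vonMangoldt n : ℝ) / Real.sqrt n * (Real.log m - Real.log n)
        else 0) := by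
  have hm1 : (1 : ℝ) ≤ m := by exact_mod_cast hm
  unfold deletedHinge
  rw [abs_of_nonneg (Real.log_nonneg hm1), Real.exp_log (by linarith), Nat.floor_natCast]

/-- `φ_D(log 2) = 0` for every `D` (the power `2` carries hinge `log 2 − log 2 = 0`). [folklore] -/
theorem deletedHinge_log_two (D : Finset ℕ) : deletedHinge D (Real.log 2) = 0 := by
  have h := deletedHinge_log_nat D (m := 2) (by norm_num)
  push_cast at h
  rw [h, show Finset.Icc (1 : ℕ) 2 = {1, 2} from by decide, Finset.sum_pair (by norm_num)]
  simp [Nat.minFac_one, ArithmeticFunction.vonMangoldt_apply_one]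

/-- `φ_D(log 3) = (log 2/√2)(log 3 − log 2)` for every `D ∋ 2` (the power `3`, deleted or not, carries hinge
`log 3 − log 3 = 0`). [folklore] -/
theorem deletedHinge_log_three {D : Finset ℕ} (h2 : 2 ∈ D) :
    deletedHinge D (Real.log 3) = Real.log 2 / Real.sqrt 2 * (Real.log 3 - Real.log 2) := by
  have h := deletedHinge_log_nat D (m := 3) (by norm_num)
  push_cast at h
  rw [h, show Finset.Icc (1 : ℕ) 3 = {1, 2, 3} from by decide,
    Finset.sum_insert (by decide), Finset.sum_pair (by norm_num)]
  have m2 : (2 : ℕ).minFac = 2 := by norm_num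
  have m3 : (3 : ℕ).minFac = 3 := by norm_num
  have hΛ2 : ArithmeticFunction.vonMangoldt 2 = Real.log 2 := by
    rw [ArithmeticFunction.vonMangoldt_apply_prime Nat.prime_two]; norm_num
  simp [Nat.minFac_one, ArithmeticFunction.vonMangoldt_apply_one, m2, m3, h2, hΛ2]

/-- `φ_D(log 2 − log 3) = 0` for every `D` (`e^{|log 2 − log 3|} = 3/2 < 2`). [folklore] -/
theorem deletedHinge_log_two_sub_log_three (D : Finset ℕ) :
    deletedHinge D (Real.log 2 - Real.log 3) = 0 := by
  unfold deletedHinge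
  have h23 : Real.log 2 < Real.log 3 := Real.log_lt_log (by norm_num) (by norm_num)
  have habs : |Real.log 2 - Real.log 3| = Real.log (3 / 2) := by
    rw [abs_of_neg (by linarith), Real.log_div (by norm_num) (by norm_num)]; ring
  rw [habs, Real.exp_log (by norm_num)]
  have hfl : ⌊(3 / 2 : ℝ)⌋₊ = 1 := by
    rw [Nat.floor_eq_iff (by norm_num)]; norm_num
  rw [hfl, Finset.Icc_self, Finset.sum_singleton]
  simp [Nat.minFac_one, ArithmeticFunction.vonMangoldt_apply_one]

/-- The deleted weight `φ₃ = (log 2/√2)(log 3 − log 2) ∈ [0.19872, 0.19874]`. [folklore] -/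
theorem phi3_bounds :
    (0.19872 : ℝ) ≤ Real.log 2 / Real.sqrt 2 * (Real.log 3 - Real.log 2) ∧
      Real.log 2 / Real.sqrt 2 * (Real.log 3 - Real.log 2) ≤ 0.19874 := by
  have hl2 := Real.log_two_gt_d9
  have hl2' := Real.log_two_lt_d9
  obtain ⟨hl3, hl3'⟩ := log_three_bounds
  set s := Real.sqrt 2 with hs
  have hs2 : s ^ 2 = 2 := Real.sq_sqrt (by norm_num)
  have hs0 : 0 < s := Real.sqrt_pos.mpr (by norm_num)
  have hslo : (1.414213 : ℝ) < s := by nlinarith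
  have hshi : s < (1.414214 : ℝ) := by nlinarith
  have e : Real.log 2 / s * (Real.log 3 - Real.log 2) = Real.log 2 * (Real.log 3 - Real.log 2) / s := by
    rw [div_mul_eq_mul_div]
  rw [e, le_div_iff₀ hs0, div_le_iff₀ hs0]
  have hA : 0 ≤ (Real.log 2 - 0.6931471803) * (Real.log 3 - Real.log 2 - 0.4054651078) :=
    mul_nonneg (by linarith) (by linarith)
  have hB : 0 ≤ (0.6931471808 - Real.log 2) * (0.4054651084 - (Real.log 3 - Real.log 2)) :=
    mul_nonneg (by linarith) (by linarith)
  constructor <;> nlinarith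

/-- Entry `(0,0)` of the kept `S_3`: `2Ψ(log 2) = 2(u(2,1) + C/4)`. [folklore] -/
theorem keptEntry00 (D : Finset ℕ) : keptScrewMatrix D 2 0 0 = 2 * (uR 2 1 + lerchC / 4) := by
  have hΨ := zetaScrew_log_nat 2
  push_cast at hΨ
  have e : keptScrewMatrix D 2 0 0 =
      keptScrew D (Real.log 2) + keptScrew D (Real.log 2) - keptScrew D (Real.log 2 - Real.log 2) := by
    simp [keptScrewMatrix, Matrix.of_apply]
  rw [e, sub_self, keptScrew_zero', keptScrew, deletedHinge_log_two, hΨ]; ring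

/-- Entry `(1,1)`: `2Ψ(log 3) + 2φ₃`. [folklore] -/
theorem keptEntry11 {D : Finset ℕ} (h2 : 2 ∈ D) : keptScrewMatrix D 2 1 1 =
    2 * (uR 3 1 + lerchC / 4) + 2 * (Real.log 2 / Real.sqrt 2 * (Real.log 3 - Real.log 2)) := by
  have hΨ := zetaScrew_log_nat 3
  push_cast at hΨ
  have e : keptScrewMatrix D 2 1 1 =
      keptScrew D (Real.log 3) + keptScrew D (Real.log 3) - keptScrew D (Real.log 3 - Real.log 3) := by
    simp [keptScrewMatrix, Matrix.of_apply]; norm_num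
  rw [e, sub_self, keptScrew_zero', keptScrew, deletedHinge_log_three h2, hΨ]; ring

/-- Entry `(0,1)`: `Ψ(log 2) + Ψ(log 3) + φ₃ − Ψ(log 2 − log 3)`, `Ψ(log 2 − log 3) = u(3,2) + C/4`. [folklore] -/
theorem keptEntry01 {D : Finset ℕ} (h2 : 2 ∈ D) : keptScrewMatrix D 2 0 1 =
    (uR 2 1 + lerchC / 4) + (uR 3 1 + lerchC / 4) + Real.log 2 / Real.sqrt 2 * (Real.log 3 - Real.log 2)
      - (uR 3 2 + lerchC / 4) := by
  have hΨ2 := zetaScrew_log_nat 2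
  have hΨ3 := zetaScrew_log_nat 3
  have hΨ32 := zetaScrew_log_sub_eq_uR (x := 0) (y := 1) (by norm_num)
  push_cast at hΨ2 hΨ3 hΨ32
  norm_num at hΨ32
  have e : keptScrewMatrix D 2 0 1 =
      keptScrew D (Real.log 2) + keptScrew D (Real.log 3) - keptScrew D (Real.log 2 - Real.log 3) := by
    simp [keptScrewMatrix, Matrix.of_apply]; norm_num
  rw [e]
  simp only [keptScrew]
  rw [deletedHinge_log_two, deletedHinge_log_three h2, deletedHinge_log_two_sub_log_three, hΨ2, hΨ3, hΨ32]
  ring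

/-- Entry `(1,0)` equals entry `(0,1)` (`Ψ_D` is even). [folklore] -/
theorem keptEntry10 (D : Finset ℕ) : keptScrewMatrix D 2 1 0 = keptScrewMatrix D 2 0 1 := by
  have e1 : keptScrewMatrix D 2 1 0 =
      keptScrew D (Real.log 3) + keptScrew D (Real.log 2) - keptScrew D (Real.log 3 - Real.log 2) := by
    simp [keptScrewMatrix, Matrix.of_apply]; norm_num
  have e2 : keptScrewMatrix D 2 0 1 =
      keptScrew D (Real.log 2) + keptScrew D (Real.log 3) - keptScrew D (Real.log 2 - Real.log 3) := by
    simp [keptScrewMatrix, Matrix.of_apply]; norm_num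
  rw [e1, e2, show Real.log 3 - Real.log 2 = -(Real.log 2 - Real.log 3) by ring, keptScrew_neg]; ring

/-- The kernel decision (ℚ, scale `SC = 2^48`): with `A ≤ 2·hi(u21) + C⁺s/2`, `Cc ≤ 2hi(u31) + C⁺s/2 + 2φ⁺s`,
`B ≥ lo(u21) + lo(u31) − hi(u32) + C⁻s/4 + φ⁻s ≥ 0`: `A·Cc < B²`. [folklore] -/
theorem det3CheckQ :
    (0 : ℚ) ≤ 2 * ((ug utab127 2 1).lo : ℚ) + cLoQ * (SC : ℚ) / 2 ∧
    (0 : ℚ) ≤ 2 * ((ug utab127 3 1).lo : ℚ) + cLoQ * (SC : ℚ) / 2 + 2 * (19872 * (SC : ℚ) / 100000) ∧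
    (0 : ℚ) ≤ ((ug utab127 2 1).lo : ℚ) + ((ug utab127 3 1).lo : ℚ) - ((ug utab127 3 2).hi : ℚ)
        + cLoQ * (SC : ℚ) / 4 + 19872 * (SC : ℚ) / 100000 ∧
    (2 * ((ug utab127 2 1).hi : ℚ) + cHiQ * (SC : ℚ) / 2) *
      (2 * ((ug utab127 3 1).hi : ℚ) + cHiQ * (SC : ℚ) / 2 + 2 * (19874 * (SC : ℚ) / 100000)) <
      (((ug utab127 2 1).lo : ℚ) + ((ug utab127 3 1).lo : ℚ) - ((ug utab127 3 2).hi : ℚ)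
        + cLoQ * (SC : ℚ) / 4 + 19872 * (SC : ℚ) / 100000) ^ 2 := by
  decide +kernel

/-- **DETECTION AT THE FLOOR (RH-FREE certified inequality): for every finite `D ∋ 2` the kept screw
matrix `S_3(ζ_{ℙ∖D})` has NEGATIVE determinant** (`≈ −0.0157`), hence is not positive semidefinite:
the deletion of `2` is seen by the SCREW column at `M = 3 = p₁ + 1`. [folklore] -/
theorem keptScrewMatrix_two_det_neg {D : Finset ℕ} (h2 : 2 ∈ D) : (keptScrewMatrix D 2).det < 0 := by
  rw [Matrix.det_fin_two, keptEntry10, keptEntry00, keptEntry11 h2, keptEntry01 h2]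
  obtain ⟨hA0, hC0, hB0, hlt⟩ := det3CheckQ
  obtain ⟨l21, h21⟩ := mem_uR_utab127 (a := 2) (b := 1) (by norm_num) (by norm_num) (by norm_num)
  obtain ⟨l31, h31⟩ := mem_uR_utab127 (a := 3) (b := 1) (by norm_num) (by norm_num) (by norm_num)
  obtain ⟨l32, h32⟩ := mem_uR_utab127 (a := 3) (b := 2) (by norm_num) (by norm_num) (by norm_num)
  obtain ⟨plo, phi⟩ := phi3_bounds
  have hClo : ((cLoQ : ℚ) : ℝ) ≤ lerchC := cLoQ_le_lerchC
  have hChi : lerchC ≤ ((cHiQ : ℚ) : ℝ) := lerchC_le_cHiQ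
  have hSC : (0 : ℝ) < ((SC : ℕ) : ℝ) := SC_pos
  have hA0r : (0 : ℝ) ≤ 2 * (((ug utab127 2 1).lo : ℤ) : ℝ) + ((cLoQ : ℚ) : ℝ) * (SC : ℝ) / 2 := by
    exact_mod_cast hA0
  have hC0r : (0 : ℝ) ≤ 2 * (((ug utab127 3 1).lo : ℤ) : ℝ) + ((cLoQ : ℚ) : ℝ) * (SC : ℝ) / 2
      + 2 * (19872 * (SC : ℝ) / 100000) := by
    have h' := (Rat.cast_le (K := ℝ)).2 hC0; push_cast at h'; linarith
  have hB0r : (0 : ℝ) ≤ (((ug utab127 2 1).lo : ℤ) : ℝ) + (((ug utab127 3 1).lo : ℤ) : ℝ)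
      - (((ug utab127 3 2).hi : ℤ) : ℝ) + ((cLoQ : ℚ) : ℝ) * (SC : ℝ) / 4 + 19872 * (SC : ℝ) / 100000 := by
    have h' := (Rat.cast_le (K := ℝ)).2 hB0; push_cast at h'; linarith
  have hltr : (2 * (((ug utab127 2 1).hi : ℤ) : ℝ) + ((cHiQ : ℚ) : ℝ) * (SC : ℝ) / 2) *
      (2 * (((ug utab127 3 1).hi : ℤ) : ℝ) + ((cHiQ : ℚ) : ℝ) * (SC : ℝ) / 2
        + 2 * (19874 * (SC : ℝ) / 100000)) <
      ((((ug utab127 2 1).lo : ℤ) : ℝ) + (((ug utab127 3 1).lo : ℤ) : ℝ) - (((ug utab127 3 2).hi : ℤ) : ℝ)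
        + ((cLoQ : ℚ) : ℝ) * (SC : ℝ) / 4 + 19872 * (SC : ℝ) / 100000) ^ 2 := by
    have h' := (Rat.cast_lt (K := ℝ)).2 hlt; push_cast at h'; nlinarith [h']
  set C := lerchC with hCdef
  set s := ((SC : ℕ) : ℝ) with hsdef
  set φ := Real.log 2 / Real.sqrt 2 * (Real.log 3 - Real.log 2) with hφ
  have hCs_hi : C * s ≤ ((cHiQ : ℚ) : ℝ) * s := mul_le_mul_of_nonneg_right hChi hSC.le
  have hCs_lo : ((cLoQ : ℚ) : ℝ) * s ≤ C * s := mul_le_mul_of_nonneg_right hClo hSC.le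
  have hφs_hi : φ * s ≤ 19874 * s / 100000 := by
    have := mul_le_mul_of_nonneg_right phi hSC.le; linarith
  have hφs_lo : 19872 * s / 100000 ≤ φ * s := by
    have := mul_le_mul_of_nonneg_right plo hSC.le; linarith
  -- scaled entries
  have a_le : (2 * (uR 2 1 + C / 4)) * s ≤
      2 * (((ug utab127 2 1).hi : ℤ) : ℝ) + ((cHiQ : ℚ) : ℝ) * s / 2 := by linarith
  have a_nn : 0 ≤ (2 * (uR 2 1 + C / 4)) * s := by linarith
  have c_le : (2 * (uR 3 1 + C / 4) + 2 * φ) * s ≤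
      2 * (((ug utab127 3 1).hi : ℤ) : ℝ) + ((cHiQ : ℚ) : ℝ) * s / 2 + 2 * (19874 * s / 100000) := by
    linarith
  have c_nn : 0 ≤ (2 * (uR 3 1 + C / 4) + 2 * φ) * s := by linarith
  have b_ge : (((ug utab127 2 1).lo : ℤ) : ℝ) + (((ug utab127 3 1).lo : ℤ) : ℝ) - (((ug utab127 3 2).hi : ℤ) : ℝ)
        + ((cLoQ : ℚ) : ℝ) * s / 4 + 19872 * s / 100000 ≤
      ((uR 2 1 + C / 4) + (uR 3 1 + C / 4) + φ - (uR 3 2 + C / 4)) * s := by linarith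
  have hP1 := mul_le_mul a_le c_le c_nn (le_trans a_nn a_le)
  have hP2 : ((((ug utab127 2 1).lo : ℤ) : ℝ) + (((ug utab127 3 1).lo : ℤ) : ℝ) - (((ug utab127 3 2).hi : ℤ) : ℝ)
        + ((cLoQ : ℚ) : ℝ) * s / 4 + 19872 * s / 100000) ^ 2 ≤
      (((uR 2 1 + C / 4) + (uR 3 1 + C / 4) + φ - (uR 3 2 + C / 4)) * s) ^ 2 :=
    pow_le_pow_left₀ hB0r b_ge 2
  have key : ((2 * (uR 2 1 + C / 4)) * s) * ((2 * (uR 3 1 + C / 4) + 2 * φ) * s) <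
      (((uR 2 1 + C / 4) + (uR 3 1 + C / 4) + φ - (uR 3 2 + C / 4)) * s) ^ 2 :=
    lt_of_le_of_lt hP1 (lt_of_lt_of_le hltr hP2)
  have hs2 : 0 < s * s := mul_pos hSC hSC
  have hprod : ((2 * (uR 2 1 + C / 4)) * (2 * (uR 3 1 + C / 4) + 2 * φ)
      - ((uR 2 1 + C / 4) + (uR 3 1 + C / 4) + φ - (uR 3 2 + C / 4)) *
        ((uR 2 1 + C / 4) + (uR 3 1 + C / 4) + φ - (uR 3 2 + C / 4))) * (s * s) < 0 := by
    have e : ((2 * (uR 2 1 + C / 4)) * (2 * (uR 3 1 + C / 4) + 2 * φ)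
        - ((uR 2 1 + C / 4) + (uR 3 1 + C / 4) + φ - (uR 3 2 + C / 4)) *
          ((uR 2 1 + C / 4) + (uR 3 1 + C / 4) + φ - (uR 3 2 + C / 4))) * (s * s)
        = ((2 * (uR 2 1 + C / 4)) * s) * ((2 * (uR 3 1 + C / 4) + 2 * φ) * s)
          - (((uR 2 1 + C / 4) + (uR 3 1 + C / 4) + φ - (uR 3 2 + C / 4)) * s) ^ 2 := by ring
    rw [e]
    linarith
  exact neg_of_mul_neg_left hprod hs2.le

/-- Hence for every finite `D ∋ 2` the kept `S_3(ζ_{ℙ∖D})` is NOT positive semidefinite. [folklore] -/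
theorem keptScrewMatrix_two_not_posSemidef {D : Finset ℕ} (h2 : 2 ∈ D) :
    ¬ (keptScrewMatrix D 2).PosSemidef := fun h ↦
  absurd h.det_nonneg (not_le.2 (keptScrewMatrix_two_det_neg h2))

/-! ## §6. CALIBRATION THEOREM: every kept-class-uniform W→S transfer has `f((log 2)/2) ≤ 2 = e^{2a}`

A W→S transfer schema UNIFORM OVER THE KEPT CLASS: from the kept system's Weil positivity on the window `a`
(semilocal language, for every admissible truncation `N ≥ e^{2a} − 1`) to positivity of its screw matrices
up to level `f(a)`.  The tree's RH-free transfer (`IntegerScrew.screwWindow_nonneg_of_weilPositivityOn_ratio`,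
slice `N = 0`) has `f(a) = ⌊e^{2a}⌋`; §3 shows the value `f((log 2)/2) = 2` is realised on the kept class
(`uniformWSTransfer_two_attained`), and `uniformWSTransfer_pin_two` shows NO uniform transfer does better there:
the deletion `D = {2}` is Weil-positive on `C((log 2)/2)` (window below the first visible prime; Yoshida /
banked `weilPositivityOn_one`) and screw-negative at `M = 3` (§5). -/

/-- Kept Weil positivity of `ζ_{ℙ∖D}` on the window `a`, in the tree's semilocal language: for every
truncation `N` with `e^{2a} ≤ N + 1` (all visible prime powers included) the semilocal form of the included
primes `keptPrimesBelow D N` is non-negative on `C(a)`. [cite: ConnesConsani2023, §2.1.2 (only the primes p < λ² enter QW_λ)] -/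
def KeptWeilOn (D : Finset ℕ) (a : ℝ) : Prop :=
  ∀ N : ℕ, Real.exp (2 * a) ≤ (N : ℝ) + 1 → WeilSemilocalPositivityOn (keptPrimesBelow D N) a

/-- A W→S TRANSFER UNIFORM OVER THE KEPT CLASS with level function `f`: for every finite set `D` of primes
and every window `a`, kept Weil positivity on `C(a)` implies `S_M(ζ_{ℙ∖D}) ⪰ 0` for every `M ≤ f(a)`. [folklore] -/
def UniformWSTransfer (f : ℝ → ℕ) : Prop :=
  ∀ D : Finset ℕ, (∀ p ∈ D, p.Prime) → ∀ a : ℝ, KeptWeilOn D a →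
    ∀ n : ℕ, n + 1 ≤ f a → (keptScrewMatrix D n).PosSemidef

/-- Every kept system is Weil-positive on `C((log 2)/2)` (no prime power is visible there; the tree's
semilocal/full coincidence with `N = 1` and the banked `weilPositivityOn_one`). [folklore] -/
theorem keptWeilOn_log_two_half (D : Finset ℕ) : KeptWeilOn D (Real.log 2 / 2) := by
  intro N _
  refine (weilSemilocalPositivityOn_iff_weilPositivityOn_of_le (N := 1) ?_ ?_).2 ?_
  · intro n hn hpp
    exfalso
    have := hpp.one_lt
    omega
  · norm_num
  · refine WeilPositivityOn.mono ?_ weilPositivityOn_one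
    have := Real.log_two_lt_d9
    linarith

/-- **(𝓣_DW) in the schema's language: DELETION FLOOR ⟹ kept Weil positivity on every window
`a ≤ min((log p₁)/2, 1)`**, for every truncation `N ≥ e^{2a} − 1` (RH-free: tree coincidence below the floor +
banked `weilPositivityOn_one`). [folklore] -/
theorem keptWeilOn_of_floor {D : Finset ℕ} {p₁ : ℕ} (hp₁ : 1 ≤ p₁) (hD : ∀ p ∈ D, p₁ ≤ p) {a : ℝ}
    (ha : a ≤ Real.log p₁ / 2) (ha1 : a ≤ 1) : KeptWeilOn D a := by
  intro N hN
  refine (weilSemilocalPositivityOn_iff_weilPositivityOn_of_le (N := min N (p₁ - 1)) ?_ ?_).2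
    (WeilPositivityOn.mono ha1 weilPositivityOn_one)
  · intro n hn _ q hq
    rw [Nat.mem_primeFactors] at hq
    obtain ⟨hqp, hqn, hn0⟩ := hq
    have hqle : q ≤ min N (p₁ - 1) := (Nat.le_of_dvd (Nat.pos_of_ne_zero hn0) hqn).trans hn
    have h1 := min_le_left N (p₁ - 1)
    have h2 := min_le_right N (p₁ - 1)
    simp only [keptPrimesBelow, Finset.mem_sdiff, Finset.mem_filter, Finset.mem_range]
    exact ⟨⟨by omega, hqp⟩, fun hqD ↦ by have := hD q hqD; omega⟩
  · rcases le_total N (p₁ - 1) with h | h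
    · rw [min_eq_left h]
      have hpos : (0 : ℝ) < (N : ℝ) + 1 := by positivity
      have h2a : 2 * a ≤ Real.log ((N : ℝ) + 1) := by
        rw [Real.le_log_iff_exp_le hpos]; exact hN
      linarith
    · rw [min_eq_right h]
      have hc : ((p₁ - 1 : ℕ) : ℝ) + 1 = p₁ := by
        rw [Nat.cast_sub hp₁]; push_cast; ring
      rw [hc]; exact ha

/-- Floors `p₁ ≤ 7`: the window bound `a ≤ (log p₁)/2` already lies inside the banked `a ≤ 1`. [folklore] -/
theorem keptWeilOn_of_floor_le_seven {D : Finset ℕ} {p₁ : ℕ} (hp₁ : 1 ≤ p₁) (hp7 : p₁ ≤ 7)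
    (hD : ∀ p ∈ D, p₁ ≤ p) {a : ℝ} (ha : a ≤ Real.log p₁ / 2) : KeptWeilOn D a := by
  refine keptWeilOn_of_floor hp₁ hD ha (ha.trans ?_)
  have h0 : (0 : ℝ) < p₁ := by exact_mod_cast hp₁
  have h7 : (p₁ : ℝ) ≤ 7 := by exact_mod_cast hp7
  have := Real.log_le_log h0 h7
  have hl7 : Real.log 7 < 2 := by
    rw [Real.log_lt_iff_lt_exp (by norm_num)]
    have h1 : (2.7182818283 : ℝ) < Real.exp 1 := Real.exp_one_gt_d9
    have h2 : Real.exp 2 = Real.exp 1 * Real.exp 1 := by rw [← Real.exp_add]; norm_num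
    rw [h2]; nlinarith
  linarith

/-- **CALIBRATION PIN, general form:** if the single deletion `{p}` (`p ≤ 7`) is screw-NEGATIVE at level `p + 1`,
then every W→S transfer uniform over the kept class has `f((log p)/2) ≤ p = e^{2a}` (its Weil side is RH-free by
`keptWeilOn_of_floor_le_seven`). The S-side hypothesis is kernel for `p = 2` (§5) and pencil (`M₀ = 4, 6, 8`) for
`p = 3, 5, 7`. [folklore] -/
theorem uniformWSTransfer_pin {f : ℝ → ℕ} (hT : UniformWSTransfer f) {p : ℕ} (hp : p.Prime) (hp7 : p ≤ 7)
    (hneg : ¬ (keptScrewMatrix {p} p).PosSemidef) : f (Real.log p / 2) ≤ p := by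
  by_contra h
  rw [not_le] at h
  refine hneg (hT {p} (by simpa using hp) (Real.log p / 2) ?_ p (by omega))
  exact keptWeilOn_of_floor_le_seven hp.one_lt.le hp7 (fun q hq ↦ by simp at hq; omega) le_rfl

/-- **CALIBRATION PIN (RH-free, kernel): every W→S transfer uniform over the kept class has
`f((log 2)/2) ≤ 2`** — the tree's `f(a) = ⌊e^{2a}⌋` cannot be improved at the first prime window. [folklore] -/
theorem uniformWSTransfer_pin_two {f : ℝ → ℕ} (hT : UniformWSTransfer f) : f (Real.log 2 / 2) ≤ 2 := by
  by_contra h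
  rw [not_le] at h
  have hpsd := hT {2} (by simp [Nat.prime_two]) (Real.log 2 / 2) (keptWeilOn_log_two_half {2}) 2 (by omega)
  exact keptScrewMatrix_two_not_posSemidef (D := {2}) (by simp) hpsd

/-- … and the value `2` is realised: for every finite set `D` of primes the kept `S_2` is positive definite
(§3 with `n = 1`). [folklore] -/
theorem uniformWSTransfer_two_attained (D : Finset ℕ) (hD : ∀ p ∈ D, p.Prime) :
    (keptScrewMatrix D 1).PosDef :=
  keptScrewMatrix_posDef (by norm_num) fun p hp ↦ (hD p hp).two_le

end RhIdea6.G14.Transfer
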